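import Summits.Ventures.PackingBounds.ThreePointCert.C10QAgg1
import Summits.Ventures.PackingBounds.ThreePointCert.CheckFastFZ

/-!
# A(10, arccos 1/4) ≤ 74: kernel validation of the blocks of (i') and of the `FI` expansion (part 2)

Framing: lottery ticket; floor = certified bounds/negative ranges. Venture `PackingBounds` (cell
`pub-packcert`), three-point SDP family. Integer data of a feasible point of the Bachoc–Vallentin
semidefinite program (n = 10, s = 1/4, degree d = 10, Bachoc–Vallentin
multiplier set = cell mode sym2), derived by `cert2lean_s2.py` (sdp gen 5 fork of cert2lean_lp.py) from the exact rational certificate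
`sdp-d10-deg10-s14-sym2-lp-v1.json` of the cell (exact verifier #1 + verifier #2 of the other seat), in the units of the kernel
checker `ThreePointCert.Check` + `CheckSym2` (soundness `card_le_of_cert3S2`); Gram factors offset-encoded for the
Kronecker-packed chunk validation `ThreePointCert.CheckKron` (emitter `emitleanS2.py` = lp gen 3 emitleanK.py). Generated file: plain
lists of integers / monomials.
-/

namespace Summit.Ventures.PackingBounds.ThreePointCert.C10Q

open Literature.Geometry.DiscreteGeometry Literature.Geometry.DiscreteGeometry.PolyCert PolyCert.SPoly

set_option maxRecDepth 100000 in
set_option maxHeartbeats 0 in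
/-- `FI` expansion, blocks [2] (kernel, Gram form + sorted-merge zero test). -/
theorem okF_3 : FchunkOKZ C10Q.cert.n C10Q.cert.d [FBlk.mk 2 C10Q.fw2] C10Q.dFc2 C10Q.dFc3 = true := by
  decide +kernel

set_option maxRecDepth 100000 in
set_option maxHeartbeats 0 in
/-- `FI` expansion, blocks [3] (kernel, Gram form + sorted-merge zero test). -/
theorem okF_4 : FchunkOKZ C10Q.cert.n C10Q.cert.d [FBlk.mk 3 C10Q.fw3] C10Q.dFc3 C10Q.dFc4 = true := by
  decide +kernel

set_option maxRecDepth 100000 in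
set_option maxHeartbeats 0 in
/-- `FI` expansion, blocks [4] (kernel, Gram form + sorted-merge zero test). -/
theorem okF_5 : FchunkOKZ C10Q.cert.n C10Q.cert.d [FBlk.mk 4 C10Q.fw4] C10Q.dFc4 C10Q.dFc5 = true := by
  decide +kernel

set_option maxRecDepth 100000 in
set_option maxHeartbeats 0 in
/-- `FI` expansion, blocks [5] (kernel, Gram form + sorted-merge zero test). -/
theorem okF_6 : FchunkOKZ C10Q.cert.n C10Q.cert.d [FBlk.mk 5 C10Q.fw5] C10Q.dFc5 C10Q.dFc6 = true := by
  decide +kernel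

end Summit.Ventures.PackingBounds.ThreePointCert.C10Q
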